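import Mathlib
import Literature.NumberTheory.EllipticCurves.KuriharaNumber
import Literature.NumberTheory.EllipticCurves.KatoKolyvaginPrimes
import Literature.NumberTheory.EllipticCurves.PAdicBSD
import Literature.NumberTheory.EllipticCurves.Selmer
import Literature.NumberTheory.EllipticCurves.GlobalMinimalModel
import Literature.NumberTheory.EllipticCurves.NonEisensteinPrimeOfSurjective
import HarnessLib

/-!
# Sakamoto 2024, §9.2 (Thm. 9.11, Cor. 9.14): Kurihara's conjecture on the structure of the
# `3`-Selmer group, and "main conjecture ⟺ a `δ`-minimal level exists", at `p = 3` (named facts)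

Topic `NumberTheory/EllipticCurves`, sub-directory `Sakamoto2024` (author–year; namespace = path).
Source (REFEREED): R. Sakamoto, *The theory of Kolyvagin systems for `p = 3`*, J. Théor. Nombres
Bordeaux **36** (2024), no. 3, 919–946, doi:10.5802/jtnb.1300, §9 (pp. 938–945), read on the
publisher's open PDF (store key `paper:url-b54a46bdc6c9`, 29 files, journal page `N` = file
`p00(N−917)`). The abstract theorems of the paper (Thm. 1.1 = Thm. 4.4 (1)/(2)) are already in the
tree (`Literature.NumberTheory.GaloisCohomology.Sakamoto2024.kolyvaginSystems_freeRankOne_zmod_three_pow`,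
`…kolyvaginSystems_idealOfBasis_eq_fittingIdeal_zmod_three_pow` and their `…At` forms); this file
types the APPLICATION of §9.2 to an elliptic curve over `ℚ` at `p = 3`, which the tree cited but did
not state (`Kim2025/LargeImageStructureOPEN.lean` References; `ModularCurvePeriodRatio.lean`,
docstring of `realPeriodRat_eq_unit_mul_plusPeriod_three`: "Sakamoto's mod-`3` Kurihara-number
theorem"). One small definition (`IsDeltaMinimal`, with API), one predicate
(`CyclotomicMainIdentityAt`, nothing asserted), two cite-tagged named facts (`def … : Prop`, no
`_holds`: size XL — Kato's Euler system, Mazur–Rubin, §§3–8 of the paper). Typed for the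
cross-ladder literature-typing layer (cell `bsd-littype`, seat 10); consumers: the `p = 3`
Kurihara-number routes (`Summits/BirchSwinnertonDyer/BirchSwinnertonDyer/Cruxes/TwistSupply/Lines/Sketch.lean`
(e), `Rank1Residual/Additive/X4SharpThreeKim*`, route `KimAtThreeKolyvagin`).

## The source, verbatim (pp. 938, 942–945)

§9 (p. 938): "Let `α` be a non-negative integer and `K/ℚ` a finite abelian `3`-extension. We set
`R := ℤ₃/3^α ℤ₃[Gal(K/ℚ)]` […] Let `E` be an elliptic curve over `ℚ`. Suppose that • the image of
`ρ_{E,3^∞} : G_ℚ → Aut(T₃(E)) ≅ GL₂(ℤ₃)` contains `SL₂(ℤ₃)`." Remark 9.1: "by [27, p. 8 and 9], the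
condition `im(ρ_{E,3^∞}) ⊃ SL₂(ℤ₃)` is equivalent to that `im(ρ_{E,9}) ⊃ SL₂(ℤ/9ℤ)` […] elliptic
curves with surjective mod `3` but not mod `9` representation have been classified by Elkies in
[11]." "We define an `R[G_ℚ]`-module `T` by `T := Ind^{G_ℚ}_{G_K}(E[3^α])`." (§2, p. 921: `𝒫 :=
{𝔮 ∉ S(𝓕) | 𝔮 is unramified in H_α(T)/K, Fr_𝔮 is conjugate to τ in Gal(H_α(T)/K)}`, `𝒩` the
square-free products of primes in `𝒫`, `τ ∈ G_{H_α}` with `T/(τ−1)T ≅ R`, `H_α = H(μ_{3^α},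
(𝒪_K^×)^{3^{−α}})`.) Def. 9.8 (p. 942): "the classical Selmer structure `𝓕_cl` on `T` […]
`S(𝓕_cl) = {3, ∞} ∪ S_bad(E)`, `H¹_{𝓕_cl}(ℚ_ℓ, T) = H¹_ur(ℚ_ℓ, T)` if `ℓ ≠ 3`, `im(E(K ⊗_ℚ ℚ₃) →
H¹(ℚ₃, T))` if `ℓ = 3`." **Lemma 9.9** (pp. 942–943): "Suppose that • `E` has a good ordinary
reduction at `3` and `E(𝔽₃)[3] = 0`, • `E(ℚ_ℓ)[3] = 0` for any prime `ℓ ∈ S_bad(E)`, • the Tamagawa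
factor of `E/ℚ` at `ℓ` is coprime to `3` for any prime `ℓ ∈ S_bad(E)`. Then `𝓕_cl` is cartesian and
residually self-dual." §9.2.2 (p. 943): "Suppose that `E` has a good ordinary reduction at `3` and
`E(𝔽₃)[3] = 0`. […] `[a/d] := 2π√−1 ∫_{√−1∞}^{a/d} f_E(z) dz`. Since the image of
`G_ℚ → Aut(T₃(E)) ≅ GL₂(ℤ₃)` contains `SL₂(ℤ₃)`, we have `Re([a/d])/Ω⁺_E ∈ ℤ₃` (see [15, Thm. 3.5]).
Here `Ω⁺_E` is the Néron period of the elliptic curve `E`. […] one can construct a Kolyvagin system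
`κ_E := (κ_{E,d})_{d∈𝒩} ∈ KS₀(T, 𝓕_cl)` […] `δ(κ_E)_d mod 𝔪_R = ± Σ_{a=1,(a,d)=1}^{d}
(Re([a/d])/Ω⁺_E) ∏_{ℓ∣d} log_{g_ℓ}(σ_a) ⊗ ⨂_{ℓ∣d} g_ℓ`. Here `g_ℓ ∈ Gal(ℚ(μ_ℓ)/ℚ)` is a generator
and `log_{g_ℓ} : Gal(ℚ(μ_ℓ)/ℚ) ⥲ ℤ/(ℓ−1)ℤ → 𝔽₃; g_ℓ^a ↦ a mod 3`. Following Kurihara's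
terminology, we say that `d ∈ 𝒩` is `δ`-minimal if `δ(κ_E)_d ≢ 0 (mod 𝔪_R)` and `δ(κ_E)_e ≡ 0
(mod 𝔪_R)` for any positive proper divisor `e` of `d`. Then Lemma 9.3 and Theorem 8.5 combined with
the arguments of the proofs of [25, Corollary 4.3 and Theorem 4.8] show the following theorem:
**Theorem 9.11.** (1) The following claims are equivalent. (a) The Iwasawa main conjecture for
`E/ℚ` holds true. (b) The Kolyvagin system `κ_E` is a basis of `KS₀(T, 𝓕_cl)`. (c) There is a
`δ`-minimal integer. (2) In the case that `p = 3`, the conjecture of Kurihara [14, Conjecture 2]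
holds true, that is, for any `δ`-minimal integer `d ∈ 𝒩` the `𝔽₃`-homomorphism `Sel(ℚ, E[3]) →
⨁_{ℓ∣d} E(ℚ_ℓ)/3E(ℚ_ℓ)` is an isomorphism." Remark 9.12: "When `p ≥ 5`, the conjecture of
Kurihara [14, Conjecture 2] is proved by the author in [25] and Chan-Ho Kim in [13], independently."
Remark 9.13: "Skinner and Urban proved in [26] that if there exists a prime `q ≠ 3` such that
`ord_q(N_E) = 1` and `E[3]` is ramified at `q`, then the Iwasawa main conjecture for `E/ℚ` is
valid." **Corollary 9.14** (p. 945): "For any square-free integer `d ∈ 𝒩` we have `I(δ(κ_E)_d) ⊂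
Fitt⁰_R(H¹_{𝓕^*(d)}(ℚ, T^∨(1))^∨)`, with equality if the Iwasawa main conjecture for `E/ℚ` holds
true."

## Transcription (the special case `K = ℚ`, `α = 1`: `R = 𝔽₃`, `T = T̄ = E[3]`)

* **Hypotheses as used.** Thm. 9.11 is printed with no hypothesis list of its own; it is derived
  ("Lemma 9.3 and Theorem 8.5 … show") under the standing assumptions of §9 (`im ρ_{E,3^∞} ⊇
  SL₂(ℤ₃)`) and §9.2.2 (good ordinary at `3`, `E(𝔽₃)[3] = 0`), and Theorem 8.5 applies to `𝓕_cl`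
  only through Lemma 9.9 (cartesian + residually self-dual), whose hypotheses are the three bullets
  above. `HypothesesAtThree W` records ALL of them (faithful to the proof; weaker-or-equal to the
  literal statement). For `E/ℚ`, `im ρ_{E,3^∞} ⊇ SL₂(ℤ₃)` is EQUIVALENT to the surjectivity of
  `ρ_{E,3^∞}` (its determinant, the cyclotomic character, is onto `ℤ₃^×`), spelled as in the tree's
  `kato_divisibility` (3): `ρ̄_{E,3^n}` onto for every `n`. `E(𝔽₃)[3] = 0` ⟺ `3 ∤ #Ẽ(𝔽₃)`
  (`reductionPointCount`). `E(ℚ_ℓ)[3] = 0` is spelled on the `ℚ_ℓ`-points of `W` (any model: the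
  group of `ℚ_ℓ`-points does not depend on the `ℚ`-model up to isomorphism); "Tamagawa factor
  coprime to `3` at every bad `ℓ`" ⟺ `3 ∤ ∏_ℓ c_ℓ` (`tamagawaProduct`; `c_ℓ = 1` at good `ℓ`).
* **The levels `𝒩`.** For `α = 1`, `K = ℚ`: `H_1(T) = ℚ(μ₃, E[3]) = ℚ(E[3])`, whose Galois group
  is `GL₂(𝔽₃)` (surjectivity); `τ` fixes `μ₃` (`det τ = 1`) and `E[3]/(τ−1) ≅ 𝔽₃`, so `τ` acts as
  a transvection, and all transvections of `GL₂(𝔽₃)` are conjugate (`diag(1,u)` conjugates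
  `(1 1;0 1)` to `(1 u;0 1)`). Hence `𝒫 = {ℓ ∤ 3N_E : Fr_ℓ is a transvection on E[3]} = {ℓ ∤ 3N_E :
  ℓ ≡ 1 (mod 3), Ẽ(𝔽_ℓ)[3] ≅ ℤ/3}` (= Kurihara's `𝒫_1^{(1)}`, Sakamoto 2022's `𝒫_{1,0}`; for such
  `ℓ`, `a_ℓ ≡ tr Fr_ℓ = 2 ≡ ℓ + 1 (mod 3)` automatically), independently of `τ`. In the tree's
  vocabulary: `d` is a square-free product of Kato–Kolyvagin primes of level `1` at `p = 3`
  (`Kato.IsKolyvaginProduct W 3 1 d`: `ℓ ∤ 3N_E`, `ℓ ≡ 1`, `a_ℓ ≡ ℓ + 1 (mod 3)`) all of whose prime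
  factors have CYCLIC `Ẽ(𝔽_ℓ)[3]` (`#Ẽ(𝔽_ℓ)[3] ≤ 3`, the clause of
  `Kim2022_selmerCorank_le_of_kuriharaNumber_ne_zero_cyclicLevel_of`; given `a_ℓ ≡ ℓ + 1`, `Fr_ℓ`
  has eigenvalue `1`, so "`≤ 3`" means "`≅ ℤ/3`") — `IsLevel W d`.
* **`δ`-minimality.** `δ(κ_E)_d mod 𝔪_R = ± δ̃_d`, Kurihara's number at `d` reduced mod `3`
  (Néron-period normalisation, discrete logarithms `log_{g_ℓ}`). The tree's `kuriharaNumber f 3 d ψ`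
  uses the period `Ω⁺_f` of the newform `f` of `E` (`ratPlusSymbol`) and surjective discrete
  logarithms `ψ_ℓ : (ℤ/ℓ)ˣ ↠ ℤ/3`; under the period transfer `Ω(W) = u·Ω⁺_f`, `|u|₃ = 1` (a
  HYPOTHESIS here, as in every Kurihara-number fact of the tree; discharged in print by
  Greenberg–Vatsal Rem. 3.4 + Mazur 1978, tree fact `realPeriodRat_eq_unit_mul_plusPeriod_three`)
  the two numbers differ by the unit `ū^{±1}` and by the units coming from the choice of generators
  (`kuriharaNumber_eq_zero_iff_of_surjective`), so (non-)vanishing mod `3` is the same.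
  `IsDeltaMinimal f m d ψ`: `δ_d ≠ 0` and `δ_e = 0` for every proper divisor `e` of `d`.
* **"The Iwasawa main conjecture for `E/ℚ`"** = the integral cyclotomic main conjecture at the good
  ordinary prime `3`, in the currency of the tree's bsd.S21 clause 3 (`skinner_urban_main_conjecture`,
  `PAdicBSD.lean`): for the cyclotomic `ℤ₃`-extension `κ` with generator `γ` matching the variable
  `T` and every Selmer-dual datum `S`, `X = S.X` is `Λ`-torsion and `char_Λ X = (g)` with
  `ι g = L₃(E,T) = padicLFunction f α` (`α = unitRoot W 3`). The Néron-normalised `L₃` of the source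
  differs from `padicLFunction f α` by the `3`-adic unit `u`, which does not change the ideal.
  Recorded as the predicate `CyclotomicMainIdentityAt W p f` (nothing asserted).
* **Thm. 9.11 (1)** is typed as (a) ⟺ (c) (`thm911_mainIdentity_iff_exists_deltaMinimal`); (b)
  is NOT typed (the module `KS₀(T, 𝓕_cl)` of rank-`0` Kolyvagin systems, Def. 8.1, is not in the
  tree). **Thm. 9.11 (2)** is typed in CARDINALITY form: `#Sel^{(3)}(E/ℚ) = 3^{ν(d)}`
  (`thm911_card_selmerGroup_three_eq_of_isDeltaMinimal`) — for `ℓ ∈ 𝒫`, `E(ℚ_ℓ)/3E(ℚ_ℓ) ≅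
  Ẽ(𝔽_ℓ)/3 ≅ ℤ/3`, so the printed isomorphism gives `dim_{𝔽₃} Sel(ℚ, E[3]) = ν(d)` (Sakamoto 2022
  = [25], p. 2: "this conjecture is equivalent to that `dim_{𝔽_p}(Sel(ℚ, E[p])) = ν(d)`", by
  Kurihara's injectivity); WEAKER than print (the localisation map `Sel(ℚ,E[3]) → ⨁ H¹(ℚ_ℓ, E[3])`
  onto the Kummer lines is not a tree map). "In the case that `p = 3`" in (2) is read as the case
  `R = 𝔽₃` (`α = 1`, `K = ℚ`) — the only case in which `Sel(ℚ, E[3])` is the dual Selmer module of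
  `𝓕_cl` (Remark 9.10).
* NOT typed here: Thm. 8.5 (rank-`0` Kolyvagin systems), Prop. 9.5 / Cor. 9.6 (equivariant Kato
  classes over abelian `3`-extensions `K/ℚ`, Fitting ideals over `ℤ₃/3^α[Gal(K/ℚ)]`), Cor. 9.14, the
  general `(α, K)` of Thm. 9.11 (1) — objects absent from the tree (`-- TODO(general form)`).

## Proved corollaries (appended §4; how the facts compose with the tree)

* `card_selmerGroup_three_eq_one_of_kuriharaNumber_one_ne_zero` — the level-`1` case of Thm. 9.11
  (2): under the hypotheses, `δ_1 = [0]⁺_f ≢ 0 (mod 3)` (i.e. `3 ∤ L(E,1)/Ω`) gives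
  `#Sel^{(3)}(E/ℚ) = 1`; `card_selmerGroup_three_eq_three_of_prime_level` — the prime-level case:
  `δ_1 = 0`, `δ_q ≠ 0` at a level `q ∈ 𝒫` gives `#Sel^{(3)}(E/ℚ) = 3`.
* `exists_isDeltaMinimal_of_skinnerUrban` — Rem. 9.13 made formal: Thm. 9.11 (1) together with the
  tree's Skinner–Urban fact bsd.S21 (`skinner_urban_main_conjecture`, clause 3, which needs
  `ρ_{E,3^∞}` onto — supplied by `HypothesesAtThree.surj` — and the auxiliary prime `q ∥ N_E`,
  `q ≠ 3`, `3 ∤ v_q(Δ_min)`) yields a `δ`-minimal level. All three are pure consequences of the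
  named facts taken as hypotheses (`h : thm911_…`), nothing new is assumed.

## References

* [Sakamoto2024] R. Sakamoto, J. Théor. Nombres Bordeaux 36 (2024) 919–946: §2 (p. 921), Def. 8.1,
  Thm. 8.5 (pp. 937–938), §9 (p. 938), Rem. 9.1, Def. 9.8, Lemma 9.9 (pp. 942–943), §9.2.2,
  Thm. 9.11, Rem. 9.12–9.13 (pp. 943–944), Cor. 9.14 (p. 945).
* [Sakamoto2022pSelmer] R. Sakamoto, Doc. Math. 27 (2022) 1891–1922 = arXiv:2106.03370, §1
  (Conj. 1.1, Def. 1.4, Thm. 1.2 = Cor. 4.3, Thm. 1.5 = Thm. 4.8; the `p ≥ 5` predecessor, `[25]`).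
* M. Kurihara, in *Iwasawa Theory 2012*, Contrib. Math. Comput. Sci. 7 (2014)
  317–356, Conjecture 2 (`[14]`; statement read through [25] §1 and the source's Thm. 9.11 (2)).
* [Kim2022StructureSelmer] C.-H. Kim, Amer. J. Math. 148 (2026), §1.2.2, §1.4.3 (the tree's
  `IsKolyvaginProduct`, `kuriharaNumber`). [SkinnerUrban2014] Thm. 3.6.9 (the tree's bsd.S21).
-/

noncomputable section

open scoped Classical MatrixGroups ModularForm

open CongruenceSubgroup WeierstrassCurve Literature.NumberTheory.EllipticCurves
  Literature.NumberTheory.EllipticCurves.ModularForms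

namespace Literature.NumberTheory.EllipticCurves.Sakamoto2024

/-! ## §1 `δ`-minimal levels (Kurihara; Sakamoto §9.2.2) -/

section DeltaMinimal

variable {N : ℕ} (f : CuspForm (Gamma0 N) 2) (m : ℕ)

/-- **`δ`-minimal level** (Sakamoto 2024, §9.2.2, p. 944: "we say that `d ∈ 𝒩` is `δ`-minimal if
`δ(κ_E)_d ≢ 0 (mod 𝔪_R)` and `δ(κ_E)_e ≡ 0 (mod 𝔪_R)` for any positive proper divisor `e` of `d`";
Kurihara's terminology, Sakamoto 2022 Def. 1.4: "`δ̃_d ≠ 0` and `δ̃_e = 0` for any positive proper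
divisor `e` of `d`"). Recorded for the tree's Kurihara numbers `kuriharaNumber f m · ψ ∈ ℤ/m` of a
weight-`2` cusp form `f` with a fixed system of discrete logarithms `ψ` (in the source `m = 3`,
`f = f_E`, `ψ_ℓ = log_{g_ℓ}`): the number at `d` is non-zero and the numbers at all proper
divisors `e` of `d` (Mathlib's `Nat.properDivisors`, so `e ≥ 1`) vanish. For `d = 0` the predicate
is about the junk value `kuriharaNumber f m 0`, never used.
[cite: Sakamoto2024, §9.2.2 (p. 944)] [cite: Sakamoto2022pSelmer, Def. 1.4] -/
def IsDeltaMinimal (d : ℕ) [NeZero d] (ψ : (ℓ : ℕ) → (ZMod ℓ)ˣ →* Multiplicative (ZMod m)) :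
    Prop :=
  kuriharaNumber f m d ψ ≠ 0 ∧
    ∀ (e : ℕ) (he : e ∈ d.properDivisors),
      (haveI : NeZero e := ⟨(Nat.pos_of_mem_properDivisors he).ne'⟩
       kuriharaNumber f m e ψ) = 0

variable {f m}

/-- A `δ`-minimal level has a non-vanishing Kurihara number. [cite: Sakamoto2024, §9.2.2 (p. 944)] -/
theorem IsDeltaMinimal.ne_zero {d : ℕ} [NeZero d]
    {ψ : (ℓ : ℕ) → (ZMod ℓ)ˣ →* Multiplicative (ZMod m)} (h : IsDeltaMinimal f m d ψ) :
    kuriharaNumber f m d ψ ≠ 0 :=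
  h.1

/-- At a `δ`-minimal level the Kurihara numbers of all proper divisors vanish.
[cite: Sakamoto2024, §9.2.2 (p. 944)] -/
theorem IsDeltaMinimal.eq_zero_of_mem_properDivisors {d : ℕ} [NeZero d]
    {ψ : (ℓ : ℕ) → (ZMod ℓ)ˣ →* Multiplicative (ZMod m)} (h : IsDeltaMinimal f m d ψ)
    {e : ℕ} [NeZero e] (he : e ∈ d.properDivisors) : kuriharaNumber f m e ψ = 0 := by
  have := h.2 e he
  convert this

variable (f m) in
/-- **Level `1` is `δ`-minimal iff `δ_1 = [0]⁺_f ≠ 0 (mod m)`** (no proper divisors; `δ_1 =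
L(f,1)/Ω⁺_f mod m` by `kuriharaNumber_one`): the analytic-rank-zero, `m ∤ L(E,1)/Ω` case, in which
Kurihara's prediction [14, Conj. 2] reads `Sel(ℚ, E[p]) = 0`.
[cite: Sakamoto2022pSelmer, Def. 1.4 and Conj. 1.1] -/
theorem isDeltaMinimal_one_iff (ψ : (ℓ : ℕ) → (ZMod ℓ)ˣ →* Multiplicative (ZMod m)) :
    IsDeltaMinimal f m 1 ψ ↔ kuriharaNumber f m 1 ψ ≠ 0 := by
  simp [IsDeltaMinimal]

variable (f m) in
/-- **A prime level `q` is `δ`-minimal iff `δ_q ≠ 0` and `δ_1 = 0`** (the only proper divisor of a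
prime is `1`): the first case beyond rank zero (`m ∣ L(E,1)/Ω`, e.g. `L(E,1) = 0`), in which
Kurihara's
prediction [14, Conj. 2] reads `dim Sel(ℚ, E[p]) = 1`. [cite: Sakamoto2022pSelmer, Def. 1.4] -/
theorem isDeltaMinimal_prime_iff {q : ℕ} (hq : q.Prime)
    (ψ : (ℓ : ℕ) → (ZMod ℓ)ˣ →* Multiplicative (ZMod m)) :
    (haveI : NeZero q := ⟨hq.ne_zero⟩
     IsDeltaMinimal f m q ψ) ↔
      (haveI : NeZero q := ⟨hq.ne_zero⟩
       kuriharaNumber f m q ψ ≠ 0) ∧ kuriharaNumber f m 1 ψ = 0 := by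
  haveI : NeZero q := ⟨hq.ne_zero⟩
  simp only [IsDeltaMinimal, hq.properDivisors, Finset.mem_singleton]
  constructor
  · rintro ⟨h1, h2⟩
    exact ⟨h1, by simpa using h2 1 rfl⟩
  · rintro ⟨h1, h2⟩
    refine ⟨h1, fun e he ↦ ?_⟩
    subst he
    simpa using h2

end DeltaMinimal

/-! ## §2 The setting of §9 / Lemma 9.9 at `p = 3` for `E/ℚ`, the levels `𝒩`, and the main
identity `char_Λ X = (L_p)` in the tree's currency (predicates; nothing asserted) -/

section Setting

variable (W : WeierstrassCurve ℚ) [W.IsElliptic] [W.IsGloballyMinimal]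

/-- **The hypotheses of Sakamoto 2024 §9 + Lemma 9.9 for `E/ℚ` at `p = 3` (`K = ℚ`)**, as a
structure of `Prop`s on a globally minimal model `W` of `E` (nothing asserted): (§9) `im ρ_{E,3^∞} ⊇
SL₂(ℤ₃)` — for `E/ℚ` equivalently `ρ_{E,3^∞}` onto `GL₂(ℤ₃)` (`det = χ_cyc` is onto `ℤ₃^×`), spelled
"`ρ̄_{E,3^n}` onto for every `n`" (`surj`; by Rem. 9.1 ⟺ `ρ̄_{E,9}` onto; NOT implied by `ρ̄_{E,3}`
onto — Elkies' examples); (Lemma 9.9) good reduction at `3` (`good`), ordinary (`3 ∤ a₃`,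
`ordinary`), `E(𝔽₃)[3] = 0` i.e. `3 ∤ #Ẽ(𝔽₃) = 4 − a₃` (`nonanomalous`); `E(ℚ_ℓ)[3] = 0` for every
prime `ℓ` of bad reduction, i.e. every `ℓ ∣ N_E` (`noLocalThreeTorsion`, on the `ℚ_ℓ`-points of
`W`); the Tamagawa factor at every bad `ℓ` is prime to `3`, i.e. `3 ∤ ∏_ℓ c_ℓ` (`tamagawa`).
[cite: Sakamoto2024, §9 (p. 938), Rem. 9.1, Lemma 9.9 (pp. 942–943)] -/
structure HypothesesAtThree : Prop where
  /-- `ρ_{E,3^∞} : G_ℚ → GL₂(ℤ₃)` is surjective (⟺ its image contains `SL₂(ℤ₃)`, for `E/ℚ`). -/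
  surj : ∀ n : ℕ, W.HasSurjectiveModNGaloisRep ((3 ^ n : ℕ) : ℤ)
  /-- Good reduction at `3`. -/
  good : W.HasGoodReductionAtPrime 3
  /-- Ordinary at `3`: `3 ∤ a₃`. -/
  ordinary : ¬ (3 : ℤ) ∣ W.frobeniusTrace 3
  /-- Non-anomalous at `3`: `E(𝔽₃)[3] = 0`, i.e. `3 ∤ #Ẽ(𝔽₃)`. -/
  nonanomalous : ¬ 3 ∣ reductionPointCount W 3
  /-- `E(ℚ_ℓ)[3] = 0` for every prime `ℓ` of bad reduction (`ℓ ∣ N_E`). -/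
  noLocalThreeTorsion : ∀ (ℓ : ℕ) [Fact ℓ.Prime], ℓ ∣ W.conductorNorm ℤ →
    ∀ P : (W.baseChange ℚ_[ℓ]).toAffine.Point, 3 • P = 0 → P = 0
  /-- `3 ∤ c_ℓ` for every bad `ℓ`, i.e. `3 ∤ ∏_ℓ c_ℓ`. -/
  tamagawa : ¬ 3 ∣ W.tamagawaProduct

/-- **The levels `𝒩` of Sakamoto 2024 §2 for `T = E[3]` over `ℚ`** (`α = 1`, `K = ℚ`, `S(𝓕) =
{3, ∞} ∪ S_bad(E)`): square-free `d` all of whose prime factors `ℓ` satisfy `ℓ ∤ 3N_E` and "`Fr_ℓ` is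
conjugate to `τ` in `Gal(ℚ(E[3])/ℚ) = GL₂(𝔽₃)`", i.e. (module docstring: `τ` is a transvection and
all transvections are conjugate) `ℓ ≡ 1 (mod 3)` and `Ẽ(𝔽_ℓ)[3] ≅ ℤ/3` — in the tree's vocabulary
`Kato.IsKolyvaginProduct W 3 1 d` (square-free; `ℓ ∤ 3N_E`, `ℓ ≡ 1`, `a_ℓ ≡ ℓ + 1 (mod 3)`) together
with the cyclicity clause `#Ẽ(𝔽_ℓ)[3] ≤ 3` at every `ℓ ∣ d` (points of the reduction mod `ℓ` of the
minimal model `integralModelInt W`; the spelling of `X4SharpThreeKimRefined.KuriharaIndexLeAt`). Equal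
to Kurihara's `𝒩_1^{(1)}` and Sakamoto 2022's `𝒩_{1,0}` at `p = 3`. A predicate; nothing asserted.
[cite: Sakamoto2024, §2 (p. 921) and §9 (p. 938)] [cite: Sakamoto2022pSelmer, §1 (the set 𝒫_{1,0})] -/
def IsLevel (d : ℕ) : Prop :=
  Kato.IsKolyvaginProduct W 3 1 d ∧
    ∀ (ℓ : ℕ) [Fact ℓ.Prime], ℓ ∣ d →
      Nat.card {P : ((WeierstrassCurve.integralModelInt W).map
          (Int.castRingHom (ZMod ℓ))).toAffine.Point // 3 • P = 0} ≤ 3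

omit [W.IsElliptic] in
/-- `1 ∈ 𝒩` ("the trivial ideal `1` belongs to `𝒩`", §2 p. 921). [cite: Sakamoto2024, §2 (p. 921)] -/
theorem isLevel_one : IsLevel W 1 := by
  refine ⟨⟨squarefree_one, by simp⟩, fun ℓ _ hℓ ↦ ?_⟩
  have : ℓ = 1 := Nat.dvd_one.mp hℓ
  exact absurd this (Fact.out : ℓ.Prime).one_lt.ne'

/-- **Statement (a) of Thm. 9.11 (1) — the integral cyclotomic main identity
`char_Λ X(E/ℚ_∞) = (L_p(E))`
(Mazur's statement; the source's wording is in the module docstring) at a good ordinary prime `p`, in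
the currency of the tree's bsd.S21 clause 3 (Skinner–Urban 2014 Thm. 3.6.9 as typed in
`PAdicBSD.lean`): for every
cyclotomic `ℤ_p`-extension datum `κ` of `ℚ` with topological generator `γ` matching the cyclotomic
variable and every Selmer-dual datum `S` (`X = S.X = Sel_{p^∞}(E/ℚ_∞)^∨`, `Λ = ℤ_p⟦T⟧`), `X` is
`Λ`-torsion and `char_Λ X = (g)` for some `g ∈ Λ` with `ι g = L_p(E,T) = padicLFunction f α`,
`α = unitRoot W p`, `f` the newform of `E` (the `Ω⁺_f`-normalised `p`-adic `L`-function of the tree;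
the source's `˜ξ_ℚ` is Néron-normalised — "coincides with the ordinary `p`-adic `L`-function up to
the multiplication by a unit", p. 944 — and the two generate the same ideal once `Ω(W)/Ω⁺_f` is a
`p`-adic unit, the period hypothesis of the facts below). A predicate with parameters; nothing
asserted. [cite: Sakamoto2024, Thm. 9.11 (1)(a) and §9.2.2 (p. 944)]
[cite: SkinnerUrban2014, Thm. 3.6.9 (p. 45) (the shape; tree fact bsd.S21 clause 3)] -/
def CyclotomicMainIdentityAt (p : ℕ) [Fact p.Prime] {N : ℕ} (f : CuspForm (Gamma0 N) 2) : Prop :=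
  ∀ (κ : ZpExtension ℚ p) (γ : Field.absoluteGaloisGroup ℚ), κ.IsCyclotomic → κ.IsTopGenerator γ →
    IsCyclotomicVariable p γ → ∀ S : W.SelmerDualData κ γ,
      S.IsTorsion ∧ ∃ g : IwasawaAlgebra p,
        iwasawaToPowerSeries p g = padicLFunction f (unitRoot W p : ℚ_[p]) ∧
          S.charIdeal = Ideal.span {g}

end Setting

/-! ## §3 The named facts (Thm. 9.11; REFEREED; no `_holds`) -/

/-- **Sakamoto 2024, Thm. 9.11 (1), (a) ⟺ (c), for `K = ℚ`, `α = 1`.** Let `E/ℚ` (globally minimal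
model `W`) satisfy the hypotheses of §9 and Lemma 9.9 at `p = 3` (`HypothesesAtThree W`:
`ρ_{E,3^∞}` onto; good ordinary non-anomalous at `3`; `E(ℚ_ℓ)[3] = 0` and `3 ∤ c_ℓ` at every bad
`ℓ`), let `f ∈ S₂(Γ₀(N))` be the newform of `E` (`IsNewformOf`) and assume the period transfer
`Ω(W) = u·Ω⁺_f`, `|u|₃ = 1`. THEN: statement (a) — the integral cyclotomic `3`-adic main identity
`char_Λ X(E/ℚ_∞) = (L₃(E))` for
`E/ℚ` (`CyclotomicMainIdentityAt W 3 f`; source wording in the module docstring) — holds IF AND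
ONLY IF there is a `δ`-minimal level — a
`d ∈ 𝒩` (`IsLevel W d`) and surjective discrete logarithms `ψ_ℓ : (ℤ/ℓ)ˣ ↠ ℤ/3` with
`IsDeltaMinimal f 3 d ψ` (mod-`3` Kurihara numbers: `δ̃_d ≠ 0`, `δ̃_e = 0` for all proper `e ∣ d`).
Clause (b) ("`κ_E` is a basis of `KS₀(T, 𝓕_cl)`") and the general `(α, K)` are not typed. With
Rem. 9.13 (Skinner–Urban 2014 Thm. 3.6.9 = tree fact bsd.S21 clause 3) the forward direction
yields a `δ`-minimal level whenever some `q ∥ N_E`, `q ≠ 3`, has `E[3]` ramified at `q`. Weaker than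
print. [cite: Sakamoto2024, Thm. 9.11 (1) (p. 944); §9 (p. 938), Lemma 9.9 (pp. 942–943), §9.2.2]
[cite: Sakamoto2022pSelmer, Thm. 1.2 = Cor. 4.3 (the `p ≥ 5` predecessor)] -/
def thm911_mainIdentity_iff_exists_deltaMinimal : Prop :=
  ∀ (W : WeierstrassCurve ℚ) [W.IsElliptic] [W.IsGloballyMinimal], HypothesesAtThree W →
    ∀ {N : ℕ} [NeZero N] (f : CuspForm (Gamma0 N) 2), IsNewformOf W f →
    (∃ u : ℚ, ‖(u : ℚ_[3])‖ = 1 ∧ W.realPeriodRat = u * plusPeriod f) →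
    (CyclotomicMainIdentityAt W 3 f ↔
      ∃ (d : ℕ) (_ : NeZero d), IsLevel W d ∧
        ∃ ψ : (ℓ : ℕ) → (ZMod ℓ)ˣ →* Multiplicative (ZMod 3),
          (∀ ℓ ∈ d.primeFactors, Function.Surjective (ψ ℓ)) ∧ IsDeltaMinimal f 3 d ψ)

/-- **Sakamoto 2024, Thm. 9.11 (2) — Kurihara's predicted structure of the `3`-Selmer group
[14, Conj. 2] is a THEOREM at `p = 3`; cardinality
form.** Under the same hypotheses (`HypothesesAtThree W`, newform `f`, period transfer at `3`): for
every `δ`-minimal level `d ∈ 𝒩` (`IsLevel W d`, surjective `ψ`, `IsDeltaMinimal f 3 d ψ`) the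
`3`-Selmer group of `E/ℚ` has exactly `3^{ν(d)}` elements, `#Sel^{(3)}(E/ℚ) = 3^{#primeFactors d}`
(`selmerGroup W 3 ⊆ H¹(ℚ, E[3])`), i.e. `dim_{𝔽₃} Sel(ℚ, E[3]) = ν(d)`. As printed the localisation
map `Sel(ℚ, E[3]) → ⨁_{ℓ∣d} E(ℚ_ℓ)/3E(ℚ_ℓ)` is an ISOMORPHISM; each summand is `≅ ℤ/3` for `ℓ ∈ 𝒫`
(`E(ℚ_ℓ)/3 ≅ Ẽ(𝔽_ℓ)/3`, good reduction at `ℓ ≠ 3`, cyclic `Ẽ(𝔽_ℓ)[3] ≠ 0`), whence the count;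
the map itself is not a tree object — WEAKER than print. In particular (`d = 1`): `3 ∤ L(E,1)/Ω` ⟹
`Sel(ℚ, E[3]) = 0`; (`d = q` prime): `3 ∣ [0]⁺`, `δ̃_q ≢ 0` ⟹ `Sel(ℚ, E[3]) ≅ ℤ/3`.
[cite: Sakamoto2024, Thm. 9.11 (2) (p. 944); §9 (p. 938), Lemma 9.9 (pp. 942–943), §9.2.2]
[cite: Sakamoto2022pSelmer, Thm. 1.5 and §1 ("equivalent to dim_{𝔽_p} Sel(ℚ,E[p]) = ν(d)")] -/
def thm911_card_selmerGroup_three_eq_of_isDeltaMinimal : Prop :=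
  ∀ (W : WeierstrassCurve ℚ) [W.IsElliptic] [W.IsGloballyMinimal], HypothesesAtThree W →
    ∀ {N : ℕ} [NeZero N] (f : CuspForm (Gamma0 N) 2), IsNewformOf W f →
    (∃ u : ℚ, ‖(u : ℚ_[3])‖ = 1 ∧ W.realPeriodRat = u * plusPeriod f) →
    ∀ (d : ℕ) [NeZero d], IsLevel W d →
      ∀ ψ : (ℓ : ℕ) → (ZMod ℓ)ˣ →* Multiplicative (ZMod 3),
        (∀ ℓ ∈ d.primeFactors, Function.Surjective (ψ ℓ)) → IsDeltaMinimal f 3 d ψ →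
        Nat.card (selmerGroup W 3) = 3 ^ d.primeFactors.card

/-! ## §4 Proved corollaries (appended): the level-`1` and prime-level cases of Thm. 9.11 (2),
and Rem. 9.13 (Skinner–Urban ⟹ a `δ`-minimal level exists) -/

section Corollaries

variable {W : WeierstrassCurve ℚ} [W.IsElliptic] [W.IsGloballyMinimal]

/-- **Thm. 9.11 (2) at the level `d = 1`** (`1 ∈ 𝒩`, no proper divisors): under the hypotheses of
§9 / Lemma 9.9 and the period transfer, if the level-`1` Kurihara number `δ_1 = [0]⁺_f =
L(f,1)/Ω⁺_f mod 3` is non-zero — i.e. `3 ∤ L(E,1)/Ω` — then the `3`-Selmer group of `E/ℚ` is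
trivial: `#Sel^{(3)}(E/ℚ) = 3⁰ = 1`. A consequence of the named fact
`thm911_card_selmerGroup_three_eq_of_isDeltaMinimal` (hypothesis `h`), `isLevel_one` and
`isDeltaMinimal_one_iff`; nothing else is assumed. [cite: Sakamoto2024, Thm. 9.11 (2) (p. 944)] -/
theorem card_selmerGroup_three_eq_one_of_kuriharaNumber_one_ne_zero
    (h : thm911_card_selmerGroup_three_eq_of_isDeltaMinimal) (hW : HypothesesAtThree W)
    {N : ℕ} [NeZero N] {f : CuspForm (Gamma0 N) 2} (hf : IsNewformOf W f)
    (hper : ∃ u : ℚ, ‖(u : ℚ_[3])‖ = 1 ∧ W.realPeriodRat = u * plusPeriod f)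
    (ψ : (ℓ : ℕ) → (ZMod ℓ)ˣ →* Multiplicative (ZMod 3)) (hδ : kuriharaNumber f 3 1 ψ ≠ 0) :
    Nat.card (selmerGroup W 3) = 1 := by
  have h1 := h W hW f hf hper 1 (isLevel_one W) ψ (by simp)
    ((isDeltaMinimal_one_iff f 3 ψ).mpr hδ)
  rw [Nat.primeFactors_one, Finset.card_empty, pow_zero] at h1
  exact h1

/-- **Thm. 9.11 (2) at a prime level `q ∈ 𝒫`** (proper divisors of `q` = `{1}`): under the same
hypotheses, if `δ_1 = 0` (so `3 ∣ L(E,1)/Ω`, e.g. `L(E,1) = 0`) and `δ_q ≠ 0` for a surjective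
discrete logarithm `ψ_q : (ℤ/q)ˣ ↠ ℤ/3`, then `#Sel^{(3)}(E/ℚ) = 3`, i.e. `Sel(ℚ, E[3]) ≅ ℤ/3`.
A consequence of `thm911_card_selmerGroup_three_eq_of_isDeltaMinimal` (hypothesis `h`) and
`isDeltaMinimal_prime_iff`. [cite: Sakamoto2024, Thm. 9.11 (2) (p. 944)] -/
theorem card_selmerGroup_three_eq_three_of_prime_level
    (h : thm911_card_selmerGroup_three_eq_of_isDeltaMinimal) (hW : HypothesesAtThree W)
    {N : ℕ} [NeZero N] {f : CuspForm (Gamma0 N) 2} (hf : IsNewformOf W f)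
    (hper : ∃ u : ℚ, ‖(u : ℚ_[3])‖ = 1 ∧ W.realPeriodRat = u * plusPeriod f)
    {q : ℕ} (hq : q.Prime) (hlev : IsLevel W q)
    (ψ : (ℓ : ℕ) → (ZMod ℓ)ˣ →* Multiplicative (ZMod 3)) (hψ : Function.Surjective (ψ q))
    (hδq : (haveI : NeZero q := ⟨hq.ne_zero⟩
      kuriharaNumber f 3 q ψ) ≠ 0)
    (hδ1 : kuriharaNumber f 3 1 ψ = 0) :
    Nat.card (selmerGroup W 3) = 3 := by
  haveI : NeZero q := ⟨hq.ne_zero⟩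
  have hmin : IsDeltaMinimal f 3 q ψ := (isDeltaMinimal_prime_iff f 3 hq ψ).mpr ⟨hδq, hδ1⟩
  have hsurj : ∀ ℓ ∈ q.primeFactors, Function.Surjective (ψ ℓ) := by
    intro ℓ hℓ
    rw [hq.primeFactors, Finset.mem_singleton] at hℓ
    subst hℓ
    exact hψ
  have h1 := h W hW f hf hper q hlev ψ hsurj hmin
  rw [hq.primeFactors, Finset.card_singleton, pow_one] at h1
  exact h1

/-- **Rem. 9.13 made formal: Skinner–Urban ⟹ a `δ`-minimal level exists.** Under the hypotheses
of §9 / Lemma 9.9 (`HypothesesAtThree W`), the period transfer, and Skinner–Urban's auxiliary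
prime (`q ∥ N_E`, `q ≠ 3`, `3 ∤ v_q(Δ_min)`: multiplicative reduction at `q` with `E[3]` ramified
at `q`), the tree's bsd.S21 (`skinner_urban_main_conjecture` at `p = 3` for the newform `f`,
hypothesis `hSU`; its integral clause 3 needs `ρ_{E,3^n}` onto for all `n`, which is
`HypothesesAtThree.surj`; irreducibility of `E[3]` from surjectivity by
`hasIrreducibleModPGaloisRep_of_hasSurjectiveModNGaloisRep`) gives statement (a)
(`CyclotomicMainIdentityAt W 3 f`), and Thm. 9.11 (1) (hypothesis `h911`) turns it into a
`δ`-minimal level `d ∈ 𝒩`. Pure consequence of the two named facts; nothing new is assumed.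
[cite: Sakamoto2024, Thm. 9.11 (1) and Rem. 9.13 (p. 944)] [cite: SkinnerUrban2014, Thm. 3.6.9 (p. 45)] -/
theorem exists_isDeltaMinimal_of_skinnerUrban
    (h911 : thm911_mainIdentity_iff_exists_deltaMinimal) (hW : HypothesesAtThree W)
    {N : ℕ} [NeZero N] {f : CuspForm (Gamma0 N) 2} (hf : IsNewformOf W f)
    (hper : ∃ u : ℚ, ‖(u : ℚ_[3])‖ = 1 ∧ W.realPeriodRat = u * plusPeriod f)
    (hSU : ∀ (κ : ZpExtension ℚ 3) (γ : Field.absoluteGaloisGroup ℚ),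
      skinner_urban_main_conjecture W 3 (κ := κ) (γ := γ) (f := f))
    (haux : ∃ ℓ : ℕ, ∃ _ : Fact ℓ.Prime, ℓ ≠ 3 ∧ W.HasMultiplicativeReductionAtPrime ℓ ∧
      ¬ 3 ∣ padicValInt ℓ W.minimalDiscriminantInt) :
    ∃ (d : ℕ) (_ : NeZero d), IsLevel W d ∧
      ∃ ψ : (ℓ : ℕ) → (ZMod ℓ)ˣ →* Multiplicative (ZMod 3),
        (∀ ℓ ∈ d.primeFactors, Function.Surjective (ψ ℓ)) ∧ IsDeltaMinimal f 3 d ψ := by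
  refine (h911 W hW f hf hper).mp ?_
  intro κ γ hκ hγ hγ' S
  have hsurj3 : W.HasSurjectiveModNGaloisRep ((3 : ℕ) : ℤ) := by
    simpa using hW.surj 1
  have hirr : W.HasIrreducibleModPGaloisRep 3 :=
    hasIrreducibleModPGaloisRep_of_hasSurjectiveModNGaloisRep W 3 hsurj3
  obtain ⟨htors, -, hint⟩ :=
    hSU κ γ (le_refl 3) hW.good hW.ordinary hirr haux hκ hγ hγ' hf S
  exact ⟨htors, hint hW.surj⟩

end Corollaries

end Literature.NumberTheory.EllipticCurves.Sakamoto2024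

end
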